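import Summits.QuantumFields.YangMills.Theorems.VirialFluxGapRingFrameLog
import Summits.QuantumFields.YangMills.Theorems.VirialFluxGapRegularValleyLocalise
import HarnessLib

/-!
# Route `VirialFluxGap` (YangMills): QUADRATIC GROWTH IN FRAME COORDINATES on the regular region — the input `κ|u|² ≤ F₀(P)` of the
# generic-region master estimates of the resolvent Euler field

Toward the deciding crux `VirialFluxGap.PeriodicSoftness` (item stmt-QuantumFields-24141), generic-region Euler field (memo
`fcl-p3-g40-RESOLVENT-EULER-FIELD-24141.md`).  Combining w2's regular-valley linear localisation ✓`RegularValley.exists_flat_ring_near_of_far`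
(a flat ring history `Q` with every slot within `(4L + 12L² + 40L²/ρ)·√F₀(P)` of `P`, whenever one wrap representative or the root seam of `P` has
imaginary mass `≥ ρ`) with the logarithm letter ✓`FrameHessian.exists_stdCoord_of_near`:

* ★★★ `exists_stdCoord_zero_quadraticGrowth` — for such a `ρ`-regular `P` with `F₀(P) < ρ²/(50176·L⁴)` there are standard coordinates `u`
  with `P·multiCurve(Σ u_j τ_j) 1` a ZERO of `F₀` and `(ρ²/(1053696·L⁸))·|u|² ≤ F₀(P)` — inputs (ii) of ✓`generic_drive_lower` ∕
  ✓`generic_divergence_upper` with `κ = ρ²/(1053696·L⁸)`.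

HONEST FRAMING: bookkeeping; the kernel family, the cut-offs, the central charts and the assembly are NOT here; ⟨24141⟩ stays OPEN; no stub /
crux / rung / summit is closed; the Yang–Mills mass gap is NOT proved; no summit is proved by a line.  THEOREMS ONLY (0 `def`, 0 `sorry`),
standard axioms.  Explicit-unit seat `ym-line-fcl-p3` g40 (cell ym-idea-1, free hands), `--supports stmt-QuantumFields-24141`.
References: [folklore]; [cite: Luscher1983, §2].
-/

set_option autoImplicit false

noncomputable section

open scoped Matrix BigOperators ContDiff Topology Quaternion
open MeasureTheory Set Matrix
open Literature.MathematicalPhysics.QuantumFieldTheory hiding SU2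
open Literature.MathematicalPhysics.QuantumLattice
open Literature.MathematicalPhysics.QuantumFieldTheory.SUNBakryEmery (expSU coe_expSU matTop)

namespace Summit.QuantumFields.YangMills.Theorems.VirialFluxGap.FrameHessian

open Summit.QuantumFields.YangMills.Theorems.FemtoTransferGap
open Summit.QuantumFields.YangMills.Theorems.FemtoTransferGap.TT
open Summit.QuantumFields.YangMills.Theorems.FemtoTransferGap.TwoLattice.Flat
open Summit.QuantumFields.YangMills.Theorems.VirialFluxGap.RingDeficit
open Summit.QuantumFields.YangMills.Theorems.VirialFluxGap.FrameDerivative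
open Summit.QuantumFields.YangMills.Theorems.VirialFluxGap.RegularValley

variable {L : ℕ} [NeZero L]

open scoped Matrix.Norms.Frobenius

attribute [local instance 2000] Literature.MathematicalPhysics.QuantumFieldTheory.SUNBakryEmery.matTop

/-- The chordal Frobenius distance `fd V W` is the Frobenius norm of the difference, in either order. [folklore] -/
theorem fd_eq_norm_sub (V W : SU2) : fd V W = ‖(W : Matrix (Fin 2) (Fin 2) ℂ) - (V : Matrix (Fin 2) (Fin 2) ℂ)‖ := by
  rw [fd_comm, fd, frobNorm_eq_norm]
set_option maxHeartbeats 400000 in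
/-- ★★★ **Quadratic growth in frame coordinates on the regular region.**  If one wrap representative of the slice-0 comb of `P` or its root seam
value has imaginary mass `≥ ρ > 0` and `F₀(P) < ρ²/(50176·L⁴)`, then there are standard coordinates `u : Var × Fin 3 → ℝ` such that
`P·multiCurve(Σ u_j τ_j) 1` is a zero of `F₀` and `(ρ²/(1053696·L⁸))·|u|² ≤ F₀(P)`. [cite: Luscher1983, §2] -/
theorem exists_stdCoord_zero_quadraticGrowth (P : ((Fin (2 * L - 1 + 1) → GaugeConfig 3 L SU2) × (Site 3 L → SU2))) {ρ : ℝ} (hρ : 0 < ρ)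
    (hfar : (∃ k : Fin 3, ρ ^ 2 ≤ ((su2Quat (wrapReps (P.1 0) k)).imI * (su2Quat (wrapReps (P.1 0) k)).imI +
        (su2Quat (wrapReps (P.1 0) k)).imJ * (su2Quat (wrapReps (P.1 0) k)).imJ + (su2Quat (wrapReps (P.1 0) k)).imK * (su2Quat (wrapReps (P.1 0) k)).imK)) ∨
      ρ ^ 2 ≤ ((su2Quat (P.2 0)).imI * (su2Quat (P.2 0)).imI + (su2Quat (P.2 0)).imJ * (su2Quat (P.2 0)).imJ +
        (su2Quat (P.2 0)).imK * (su2Quat (P.2 0)).imK))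
    (hρ1 : ρ ≤ 1) (hsmall : ringDeficit L (fun _ => false) P < ρ ^ 2 / (50176 * (L : ℝ) ^ 4)) :
    ∃ u : ((Fin (2 * L - 1 + 1) × Edge 3 L) ⊕ Site 3 L) × Fin 3 → ℝ,
      ringDeficit L (fun _ => false)
          (P * multiCurve (dirOf (stdFrame (L := L)) u) (dirOf_conjTranspose (fun j w => stdFrame_conjTranspose j w) u)
            (dirOf_trace (fun j w => stdFrame_trace j w) u) 1) = 0 ∧
      ρ ^ 2 / (1053696 * (L : ℝ) ^ 8) * (u ⬝ᵥ u) ≤ ringDeficit L (fun _ => false) P := by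
  classical
  set F := ringDeficit L (fun _ => false) P with hF
  have hF0 : 0 ≤ F := ringDeficit_nonneg _ _
  have hL1 : (1 : ℝ) ≤ L := by exact_mod_cast NeZero.one_le
  have hL4 : (1 : ℝ) ≤ (L : ℝ) ^ 4 := one_le_pow₀ hL1
  set δ := Real.sqrt F with hδ
  have hδ0 : 0 ≤ δ := Real.sqrt_nonneg _
  have hδ2 : δ ^ 2 = F := Real.sq_sqrt hF0
  obtain ⟨Q, hQ0, hQ1, hQ2⟩ := exists_flat_ring_near_of_far P hρ hfar
  -- the common slot bound `m = (4L + 12L² + 40L²/ρ)·δ ≤ 56L²δ/ρ`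
  set m : ℝ := 4 * (L : ℝ) * δ + 12 * (L : ℝ) ^ 2 * δ + 40 * (L : ℝ) ^ 2 * δ / ρ with hm
  have hm1 : ∀ (i : Fin (2 * L - 1 + 1)) (e : Edge 3 L),
      ‖(Q.1 i e : Matrix (Fin 2) (Fin 2) ℂ) - (P.1 i e : Matrix (Fin 2) (Fin 2) ℂ)‖ ≤ m := by
    intro i e; rw [← fd_eq_norm_sub]; exact hQ1 i e
  have hm2 : ∀ x : Site 3 L, ‖(Q.2 x : Matrix (Fin 2) (Fin 2) ℂ) - (P.2 x : Matrix (Fin 2) (Fin 2) ℂ)‖ ≤ m := by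
    intro x; rw [← fd_eq_norm_sub]
    have h := hQ2 x
    have h4 : 0 ≤ 4 * (L : ℝ) * δ := by positivity
    linarith
  have hm_le : m ≤ 56 * (L : ℝ) ^ 2 * δ / ρ := by
    have h1 : 4 * (L : ℝ) * δ ≤ 4 * (L : ℝ) ^ 2 * δ / ρ := by
      rw [le_div_iff₀ hρ]
      have : 4 * (L : ℝ) * δ * ρ ≤ 4 * (L : ℝ) * δ * 1 := mul_le_mul_of_nonneg_left hρ1 (by positivity)
      nlinarith [mul_nonneg (by positivity : (0 : ℝ) ≤ 4 * δ) (by nlinarith : (0 : ℝ) ≤ (L : ℝ) ^ 2 - L)]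
    have h2 : 12 * (L : ℝ) ^ 2 * δ ≤ 12 * (L : ℝ) ^ 2 * δ / ρ := by
      rw [le_div_iff₀ hρ]
      have : 12 * (L : ℝ) ^ 2 * δ * ρ ≤ 12 * (L : ℝ) ^ 2 * δ * 1 := mul_le_mul_of_nonneg_left hρ1 (by positivity)
      linarith
    have e : 56 * (L : ℝ) ^ 2 * δ / ρ = 4 * (L : ℝ) ^ 2 * δ / ρ + 12 * (L : ℝ) ^ 2 * δ / ρ + 40 * (L : ℝ) ^ 2 * δ / ρ := by ring
    rw [e, hm]; linarith
  have hm0 : 0 ≤ m := by rw [hm]; positivity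
  have hm2sq : m ^ 2 ≤ 3136 * (L : ℝ) ^ 4 * F / ρ ^ 2 := by
    have h1 : m ^ 2 ≤ (56 * (L : ℝ) ^ 2 * δ / ρ) ^ 2 := pow_le_pow_left₀ hm0 hm_le 2
    have e : (56 * (L : ℝ) ^ 2 * δ / ρ) ^ 2 = 3136 * (L : ℝ) ^ 4 * F / ρ ^ 2 := by
      rw [div_pow, mul_pow, mul_pow, ← pow_mul, hδ2]; norm_num
    rw [← e]; exact h1
  have hmlt : m < 1 / 4 := by
    have h1 : m ^ 2 < 1 / 16 := by
      have h2 : 3136 * (L : ℝ) ^ 4 * F / ρ ^ 2 < 3136 * (L : ℝ) ^ 4 * (ρ ^ 2 / (50176 * (L : ℝ) ^ 4)) / ρ ^ 2 := by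
        apply div_lt_div_of_pos_right _ (by positivity)
        exact mul_lt_mul_of_pos_left hsmall (by positivity)
      have e : 3136 * (L : ℝ) ^ 4 * (ρ ^ 2 / (50176 * (L : ℝ) ^ 4)) / ρ ^ 2 = 1 / 16 := by
        field_simp; norm_num
      linarith [hm2sq]
    nlinarith
  obtain ⟨u, huQ, huu⟩ := exists_stdCoord_of_near P Q (fun i e => lt_of_le_of_lt (hm1 i e) hmlt) (fun x => lt_of_le_of_lt (hm2 x) hmlt)
  refine ⟨u, by rw [huQ]; exact hQ0, ?_⟩
  -- `|u|² ≤ 48 · (#slots) · m² ≤ 48·7L⁴·3136L⁴F/ρ²`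
  have hs1 : ∑ i : Fin (2 * L - 1 + 1), ∑ e : Edge 3 L, ‖(Q.1 i e : Matrix (Fin 2) (Fin 2) ℂ) - (P.1 i e : Matrix (Fin 2) (Fin 2) ℂ)‖ ^ 2 ≤
      (Fintype.card (Fin (2 * L - 1 + 1)) : ℝ) * ((Fintype.card (Edge 3 L) : ℝ) * m ^ 2) := by
    calc _ ≤ ∑ _i : Fin (2 * L - 1 + 1), ∑ _e : Edge 3 L, m ^ 2 :=
          Finset.sum_le_sum fun i _ => Finset.sum_le_sum fun e _ => pow_le_pow_left₀ (norm_nonneg _) (hm1 i e) 2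
      _ = _ := by simp
  have hs2 : ∑ x : Site 3 L, ‖(Q.2 x : Matrix (Fin 2) (Fin 2) ℂ) - (P.2 x : Matrix (Fin 2) (Fin 2) ℂ)‖ ^ 2 ≤
      (Fintype.card (Site 3 L) : ℝ) * m ^ 2 := by
    calc _ ≤ ∑ _x : Site 3 L, m ^ 2 := Finset.sum_le_sum fun x _ => pow_le_pow_left₀ (norm_nonneg _) (hm2 x) 2
      _ = _ := by simp
  have hcF : (Fintype.card (Fin (2 * L - 1 + 1)) : ℝ) = 2 * L := by
    rw [Fintype.card_fin]
    have : 2 * L - 1 + 1 = 2 * L := by have := NeZero.one_le (n := L); omega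
    rw [this]; push_cast; ring
  have hcE : (Fintype.card (Edge 3 L) : ℝ) = 3 * (L : ℝ) ^ 3 := by
    simp only [Fintype.card_prod, Fintype.card_fun, ZMod.card, Fintype.card_fin]
    push_cast; ring
  have hcS : (Fintype.card (Site 3 L) : ℝ) = (L : ℝ) ^ 3 := by
    simp only [Fintype.card_fun, ZMod.card, Fintype.card_fin]
    push_cast; ring
  rw [hcF, hcE] at hs1
  rw [hcS] at hs2
  have hL3 : (L : ℝ) ^ 3 ≤ (L : ℝ) ^ 4 := by
    calc (L : ℝ) ^ 3 = (L : ℝ) ^ 3 * 1 := (mul_one _).symm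
      _ ≤ (L : ℝ) ^ 3 * L := mul_le_mul_of_nonneg_left hL1 (by positivity)
      _ = (L : ℝ) ^ 4 := by ring
  have hm2' : 0 ≤ m ^ 2 := sq_nonneg _
  have htot : u ⬝ᵥ u ≤ 336 * (L : ℝ) ^ 4 * m ^ 2 := by
    have h7 : 2 * (L : ℝ) * (3 * (L : ℝ) ^ 3 * m ^ 2) + (L : ℝ) ^ 3 * m ^ 2 ≤ 7 * (L : ℝ) ^ 4 * m ^ 2 := by
      nlinarith [mul_le_mul_of_nonneg_right hL3 hm2']
    linarith [huu, hs1, hs2]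
  have hfin : u ⬝ᵥ u ≤ 1053696 * (L : ℝ) ^ 8 * F / ρ ^ 2 := by
    calc u ⬝ᵥ u ≤ 336 * (L : ℝ) ^ 4 * m ^ 2 := htot
      _ ≤ 336 * (L : ℝ) ^ 4 * (3136 * (L : ℝ) ^ 4 * F / ρ ^ 2) := mul_le_mul_of_nonneg_left hm2sq (by positivity)
      _ = 1053696 * (L : ℝ) ^ 8 * F / ρ ^ 2 := by ring
  rw [div_mul_eq_mul_div, div_le_iff₀ (by positivity)]
  rw [le_div_iff₀ (by positivity)] at hfin
  linarith

end Summit.QuantumFields.YangMills.Theorems.VirialFluxGap.FrameHessian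

end
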